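import Literature.Analysis.FluidPDE.GalerkinFlow
import Literature.Analysis.FluidPDE.NSGalerkinFamilyLimit

/-!
# Route MomentParity · `GalerkinEnsembleRealization` — Galerkin orbits form a Hopf–Galerkin family

For the realisation step of stmt-AnomalousDissipation-11466: given Galerkin orders `N j → ∞`,
phase-space data `c j ∈ galerkinSubspace (freqBall (N j))` of energy `∑ ‖c j k‖² ≤ R²`, a steady
smooth force `f` and `ν ≥ 0`, the Galerkin orbits
`U j t = galerkinFlow ν f (N j) t (realTrigPoly (c j)‾)` form an `IsHopfGalerkinFamily` (the
scheme notion of `NSGalerkinFamilyLimit` without the rigid initial clause) with the steady forces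
`F j = f` and the constant reference datum `x ↦ R e₀` (energy `R²`).  All clauses are those of
`IsGalerkinMode.galerkinFlow_clauses`; we also record the Fourier coefficients of the orbits and
the bookkeeping facts about the steady force used by the limit theorems
(`stLift (fun _ => f)` is smooth, `∫₀ᵀ ∫ ‖f‖ₑ² < ∞`).
-/

noncomputable section

open MeasureTheory Set Filter Topology Function UnitAddTorus
open scoped InnerProductSpace RealInnerProductSpace ENNReal

namespace Summit.AnomalousDissipation.AnomalousDissipation.Theorems.MomentParity

set_option linter.dupNamespace false

open Literature.Analysis.FunctionSpaces Literature.Analysis.FunctionSpaces.Torus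
open Literature.Analysis.FluidPDE Literature.Analysis.FluidPDE.Torus

variable {ν : ℝ} {f : UnitAddTorus (Fin 3) → EuclideanSpace ℝ (Fin 3)}

/-! ### The steady force -/

/-- A time-independent smooth field on `T³` is jointly smooth on `ℝ × ℝ³` (as the lift
`stLift (fun _ => f) = lift f ∘ Prod.snd`). -/
theorem contDiff_stLift_const (hf : IsSmooth f) :
    ContDiff ℝ ((⊤ : ℕ∞) : WithTop ℕ∞) (stLift fun _ : ℝ => f) := by
  have h : stLift (fun _ : ℝ => f) = lift f ∘ Prod.snd := rfl
  rw [h]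
  exact hf.comp contDiff_snd

/-- The space–time lift of a steady smooth force is (strongly) measurable for every measure. -/
theorem aestronglyMeasurable_stLift_const (hf : IsSmooth f)
    (μ : Measure (ℝ × EuclideanSpace ℝ (Fin 3))) :
    AEStronglyMeasurable (stLift fun _ : ℝ => f) μ :=
  (contDiff_stLift_const hf).continuous.aestronglyMeasurable

/-- `∫ ‖f‖ₑ² < ∞` for a smooth field on the torus. -/
theorem lintegral_enorm_sq_lt_top_of_isSmooth (hf : IsSmooth f) : ∫⁻ x, ‖f x‖ₑ ^ 2 < ⊤ := by
  have h := (hf.memLp 2).2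
  rw [eLpNorm_lt_top_iff_lintegral_rpow_enorm_lt_top two_ne_zero ENNReal.ofNat_ne_top] at h
  simpa [ENNReal.toReal_ofNat] using h

/-- The steady force has finite space–time `L²` norm on every slab `(0, T) × T³`. -/
theorem lintegral_force_lt_top (hf : IsSmooth f) (T : ℝ) :
    ∫⁻ _ in Ioo (0 : ℝ) T, ∫⁻ x, ‖f x‖ₑ ^ 2 < ⊤ := by
  rw [setLIntegral_const]
  exact ENNReal.mul_lt_top (lintegral_enorm_sq_lt_top_of_isSmooth hf) measure_Ioo_lt_top

/-! ### The orbits -/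

/-- The Fourier coefficients of the Galerkin orbit of a phase-space vector:
`𝓕(galerkinFlow t (realTrigPoly c̄))(k) = (φ_t c)‾ k` for every `k ∈ ℤ³`. -/
theorem mFourierCoeff_galerkinFlow_realTrigPoly {N : ℕ}
    {c : ↥(freqBall (d := Fin 3) N) → EuclideanSpace ℂ (Fin 3)}
    (hc : c ∈ galerkinSubspace (freqBall N)) (t : ℝ) (k : Fin 3 → ℤ) :
    mFourierCoeff (EuclideanSpace.complexify ∘
        galerkinFlow ν f N t (realTrigPoly (freqBall N) (coeffExt (freqBall N) c))) k =
      coeffExt (freqBall N) (galerkinCoeffFlow ν (fourierRestrict (freqBall N) f) t c) k := by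
  rw [galerkinFlow_realTrigPoly hc,
    mFourierCoeff_realTrigPoly neg_mem_freqBall_of_mem
      ((galerkinCoeffFlow_mem hc t).1.isConjSymm_coeffExt neg_mem_freqBall_of_mem)]
  by_cases hk : k ∈ freqBall N
  · rw [if_pos hk]
  · rw [if_neg hk, coeffExt_of_not_mem _ hk]

/-- The energy of the field of a phase-space vector is the energy of its coefficients:
`∫ ‖realTrigPoly c̄‖² = ∑_{k ∈ freqBall N} ‖c̄ k‖²`. -/
theorem integral_norm_sq_realTrigPoly_coeffExt {N : ℕ}
    {c : ↥(freqBall (d := Fin 3) N) → EuclideanSpace ℂ (Fin 3)}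
    (hc : c ∈ galerkinSubspace (freqBall N)) :
    ∫ x, ‖realTrigPoly (freqBall N) (coeffExt (freqBall N) c) x‖ ^ 2 =
      ∑ k ∈ freqBall N, ‖coeffExt (freqBall N) c k‖ ^ 2 :=
  integral_norm_sq_realTrigPoly neg_mem_freqBall_of_mem
    (hc.1.isConjSymm_coeffExt neg_mem_freqBall_of_mem)

/-- The constant reference datum `x ↦ R e₀` has energy `R²`. -/
theorem integral_norm_sq_const_single (R : ℝ) :
    ∫ _ : UnitAddTorus (Fin 3), ‖(EuclideanSpace.single (0 : Fin 3) R : EuclideanSpace ℝ (Fin 3))‖ ^ 2 =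
      R ^ 2 := by
  rw [integral_const, EuclideanSpace.single, PiLp.norm_single, Real.norm_eq_abs, sq_abs, smul_eq_mul]
  simp

/-- **Galerkin orbits of bounded energy form a Hopf–Galerkin family.**  For orders `N j → ∞`,
phase-space data `c j ∈ galerkinSubspace (freqBall (N j))` with `∑ ‖(c j)‾ k‖² ≤ R²`, a steady
smooth force `f` and `ν ≥ 0`, the orbits `U j t = galerkinFlow ν f (N j) t (realTrigPoly (c j)‾)`
satisfy every clause of `IsHopfGalerkinFamily` with forces `F j = f` and reference datum
`x ↦ R e₀`. -/
theorem isHopfGalerkinFamily_galerkinFlow (hν : 0 ≤ ν) (hf : IsSmooth f) {N : ℕ → ℕ}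
    (hN : Tendsto N atTop atTop)
    {c : (j : ℕ) → ↥(freqBall (d := Fin 3) (N j)) → EuclideanSpace ℂ (Fin 3)}
    (hc : ∀ j, c j ∈ galerkinSubspace (freqBall (N j))) {R : ℝ}
    (hR : ∀ j, ∑ k ∈ freqBall (N j), ‖coeffExt (freqBall (N j)) (c j) k‖ ^ 2 ≤ R ^ 2) :
    IsHopfGalerkinFamily ν (fun _ => f) (fun _ => EuclideanSpace.single (0 : Fin 3) R) N
      (fun _ _ => f)
      (fun j t => galerkinFlow ν f (N j) t
        (realTrigPoly (freqBall (N j)) (coeffExt (freqBall (N j)) (c j)))) := by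
  have hcl := fun j =>
    (isGalerkinMode_realTrigPoly_coeffExt (hc j)).galerkinFlow_clauses (ν := ν) (f := f) hν (hf.memLp 2)
  refine
    { tendsto_order := hN
      smooth_force := fun _ => contDiff_stLift_const hf
      tendsto_force := fun T _ => ?_
      continuousOn := fun j => (hcl j).2.1
      isGalerkinMode := fun j t ht => ((hcl j).2.2.1 t ht).1
      isWeaklyDivFree := fun j t ht => ((hcl j).2.2.1 t ht).2
      galerkin := fun j a ha s t hs hst => (hcl j).2.2.2.1 a ha s t hs hst
      energy_eq := fun j s t hs hst => (hcl j).2.2.2.2 s t hs hst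
      initial_bound := fun j => ?_ }
  · simp only [sub_self, enorm_zero, ne_eq, OfNat.ofNat_ne_zero, not_false_eq_true, zero_pow,
      lintegral_const, zero_mul]
    exact tendsto_const_nhds
  · rw [galerkinFlow_zero, integral_norm_sq_realTrigPoly_coeffExt (hc j),
      integral_norm_sq_const_single]
    exact hR j

end Summit.AnomalousDissipation.AnomalousDissipation.Theorems.MomentParity
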